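import Summits.QuantumFields.YangMills.Theorems.AlphaInputsT3ACv3RecordSelXsChi
import Summits.QuantumFields.YangMills.Theorems.AlphaInputsT3ACv3SmallFactor71Sym
import Summits.QuantumFields.YangMills.Theorems.AlphaInputsT3ACv3SmallFactor
import HarnessLib

/-!
# `AlphaInputsT3ACv3SmallFactor71SymT3` — THE R-ii SEAM ROW OF RECORD, SUPPLIER SIDE: the v4 package's `h71` text ([Balaban1985UV3] (71) per recorded plaquette; ★★OWNER RULING
# g26-№14, ★alpha-2 g7 ✓P1 `RunAlphaV4CoreAC.h71`) FROM an abstract large quantity `v ≥ g_jp(g_j)` obeying (69), read-local (68) and the (71)-window — in the LANE's letters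
# (generic `S`, `𝔊`, `𝔠`; §1) and at the T³ objects for a configuration in the α-currency class rows `large67RecSet ∩ reg68LocalSet` of B1 with (69)_sym (§2) — NO comb letter, NO κ —
# cell `ym3-torus`, crux stmt-QuantumFields-19936 (`HistoryTailL`, (O″χ) B1 seam), LEAD seat `ym-ust-19936-w1` (g3)

WHAT (def-free).  §1 ★★ `SmallFactor71Sym.h71_of_large69` (lane-generic, the shape of ★alpha-1 g3's ✓`AlphaV3AC.eq71_perPlaquette_of_alphaV3` with the rows `hLF67`∕`h68` replaced by: an
ABSTRACT `v` with `eps1Of S 𝔠 j ≤ v` (largeness in ANY currency), (69) for `v` against the rigid sum of the lift (`blockSum … (dev (liftCfg 𝔊 U₀) …) + b`, `b ≤ C₂·eps1Of²`), (68) as the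
`reg68LocalSet` inequality (`pdevOn ≤ ½C68·eps1Of·L^{−2j}`), and the window `eps1Of ≤ 1 ∧ ½(2C68·C₂ + C₂²)·eps1Of ≤ ¼`): conclusion LETTER FOR LETTER the v4 `h71` field at `U_k(h,U) := U₀`:
`p(g_j)²/4 ≤ N·((1/g_k²)·Σ_{q ∈ regionT e} η_k⁻¹[1 − reTr U₀(∂q)])` — proof = ✓`smallFactor_of_large69_unitary` (✓p614417) + `g_k² = g_j²L^{k−j}` + the plaquette bridge
`LiftBridge.bridge_liftCfg`∕`projSite_injOn_deltaBox` exactly as in `eq71_perPlaquette_of_alphaV3`.  §2 ★★★ `AlphaInputsT3AC.h71_of_recLarge_of_eq69sym` — the T³ instance: `U₀ ∈ large67RecSet k h`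
(recording currency, `v := dist1((blockAvg ℰp)^j U₀)(∂p′)`) ∧ `U₀ ∈ reg68LocalSet k h` ∧ (69)_sym for `U₀` (displayed INLINE in the B1 team's target shape — pieces (i) ✓`…LinAvgIterFluxRigid`
(★w6 g2), (ii) `…SymAvgGaugeClamp` (★w2 g4), (iii) `…SymAvgPlaqAssembly` (★w7 g3), (iv)) ∧ the window ⇒ the `h71` text at `S := T3Scales …`, `𝔊 := suGroupModel 2`.
HONEST FRAMING.  (69)_sym is a HYPOTHESIS here; the window is displayed; nothing of [B10] is asserted; the stub 2′χ, the crux and any gap are NOT claimed; count-neutral helper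
(`--supports stmt-QuantumFields-19936`).  YM₃ on the three-torus is rung R3 of the programme, NOT the Clay problem: nothing here bears on d = 4, infinite volume, or a mass gap.

References: T. Bałaban, Commun. Math. Phys. 102 (1985) 255–275 [Balaban1985UV3] ((7) p.257, (67)–(71) p.273); Commun. Math. Phys. 98 (1985) 17–51 [Balaban1985Averaging]
(Prop 2 (52)–(54) p.26).
-/

set_option autoImplicit false

noncomputable section

open MeasureTheory
open scoped BigOperators Matrix.Norms.L2Operator
open Literature.MathematicalPhysics.QuantumFieldTheory.Balaban1983to89
open Literature.MathematicalPhysics.QuantumFieldTheory.Balaban1983to89.B10Eq70Squaring (deltaBox blockSum dev)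
open Literature.MathematicalPhysics.QuantumFieldTheory.Balaban1985CMP102
open Literature.MathematicalPhysics.QuantumFieldTheory.Balaban1985CMP102.Setting
open Summit.QuantumFields.Balaban3D.Carriers
open Summit.QuantumFields.Balaban3D.Proofs.Primitives
open Summit.QuantumFields.Balaban3D.Proofs.ScalesArithmetic (gk_pos gk_le_one gk_eq_gRun_norm g0sq_pos L_pos)
open Summit.QuantumFields.Balaban3D.Proofs.CouplingWindow (gRun_sq_scale pFun_pos)
open Summit.QuantumFields.Balaban3D.Proofs.TorusLift (projSite zOf projSite_injOn_deltaBox)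
open Summit.QuantumFields.Balaban3D.Proofs.LiftBridge (liftCfg liftCfg_mem_unitaryUnits bridge_liftCfg)
open Summit.QuantumFields.Balaban3D.Proofs.Run3SmallFactors (codeZ regionT decode_of_mem_disc)
open B7Prop1Explicit (hol plaqWord)
open B7Prop1Local (pdevOn loK plaqHiK)

/-! ## §1 Lane-generic: the v4 `h71` text from an abstract large quantity obeying (69), read-local (68), and the window -/

namespace Summit.QuantumFields.YangMills.Theorems.SmallFactor71Sym

variable {L : ℕ} {S : Scales L} {G : Type} [GaugeGroup G] [MeasurableSpace G] {𝔊 : GroupModel G} {𝔠 : AlphaConsts L 𝔊.N}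

/-- ★★ **THE v4 `h71` TEXT FROM AN ABSTRACT LARGE QUANTITY** (lane letters): for `k ≤ K`, a history `h`, a configuration `U₀`, a recorded code `e = (j, code p′) ∈ P(h)` (`j < k`), any real `v`
with `eps1Of S 𝔠 j ≤ v` and (69) `v < blockSum (Lʲ) (Lʲ•codeZ e) μ ν (dev (liftCfg 𝔊 U₀) μ ν) + b`, `0 ≤ b ≤ C₂·eps1Of²`, read-local (68) `pdevOn ≤ ½C68·eps1Of·L^{−2j}` on `Δ′(e)`, and the window
`eps1Of ≤ 1`, `½(2C68·C₂ + C₂²)·eps1Of ≤ ¼`: `p(g_j)²/4 ≤ N·((1/g_k²)·Σ_{q ∈ regionT e} η_k⁻¹[1 − reTr U₀(∂q)])`. [cite: Balaban1985UV3, (67)–(71) p.273] -/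
theorem h71_of_large69 (hL2 : 2 ≤ L) {k : ℕ} (hk : k ≤ S.K) {h : Hist S.P k} (U₀ : GaugeField S.P 0 G) {e : ℕ × PlaqCode S.P}
    (he : e ∈ Hist.disc h) {v b C₂ : ℝ} (hv : eps1Of S 𝔠.lane.carrier e.1 ≤ v)
    (h68 : pdevOn (loK L e.1 (codeZ e)) (plaqHiK L e.1 (codeZ e) e.2.2.1 e.2.2.2) (liftCfg 𝔊 U₀) ≤
      𝔠.C68 / 2 * (S.gk e.1 * B10.pFun 𝔠.lane.carrier.b₀ 𝔠.lane.carrier.p₀ (S.gk e.1)) * (((L : ℝ) ^ e.1)⁻¹) ^ 2)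
    (h69 : v < blockSum (L ^ e.1) ((L ^ e.1 : ℕ) • codeZ e) e.2.2.1 e.2.2.2 (dev (liftCfg 𝔊 U₀) e.2.2.1 e.2.2.2) + b) (hb : 0 ≤ b)
    (hbB : b ≤ C₂ * eps1Of S 𝔠.lane.carrier e.1 ^ 2)
    (hwin : eps1Of S 𝔠.lane.carrier e.1 ≤ 1 ∧ (2 * 𝔠.C68 * C₂ + C₂ ^ 2) / 2 * eps1Of S 𝔠.lane.carrier e.1 ≤ 1 / 4) :
    B10.pFun 𝔠.lane.carrier.b₀ 𝔠.lane.carrier.p₀ (S.gk e.1) ^ 2 / 4 ≤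
      (𝔊.N : ℝ) * ((S.gk k)⁻¹ ^ 2 * ∑ q ∈ regionT e, (S.eta k)⁻¹ * (1 - reTr (GaugeField.plaqHol U₀ q))) := by
  classical
  haveI : NeZero 𝔊.N := ⟨Nat.pos_iff_ne_zero.mp 𝔊.N_pos⟩
  obtain ⟨j, hj, p', hp', hej, hz, hμ, hν⟩ := decode_of_mem_disc he
  have hμν : e.2.2.1 < e.2.2.2 := by rw [hμ, hν]; exact p'.hμν
  have he1 : e.1 = j := by rw [hej]
  have hek : e.1 ≤ k := by omega
  have heK : e.1 ≤ S.K := hek.trans hk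
  have hLr0 : (0 : ℝ) ≤ (L : ℝ) := by positivity
  have hgj : 0 < S.gk e.1 := gk_pos S e.1
  have hgj1 : S.gk e.1 ≤ 1 := gk_le_one S S.gK_le_one e.1 heK
  have hpj : 0 < B10.pFun 𝔠.lane.carrier.b₀ 𝔠.lane.carrier.p₀ (S.gk e.1) := pFun_pos _ _ _ 𝔠.b₀_pos hgj hgj1
  have hε : eps1Of S 𝔠.lane.carrier e.1 = S.gk e.1 * B10.pFun 𝔠.lane.carrier.b₀ 𝔠.lane.carrier.p₀ (S.gk e.1) := rfl
  have hgk : S.gk k ^ 2 = S.gk e.1 ^ 2 * (L : ℝ) ^ (k - e.1) := by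
    rw [gk_eq_gRun_norm S k, gk_eq_gRun_norm S e.1]
    exact gRun_sq_scale 1 (L : ℝ) S.g0sq hLr0 (g0sq_pos S).le hek
  obtain ⟨hgp, hsmall⟩ := hwin
  rw [hε] at hgp hsmall hv hbB
  have hsmall' : (2 * 𝔠.C68 * C₂ + C₂ ^ 2) / 2 * S.gk e.1 * B10.pFun 𝔠.lane.carrier.b₀ 𝔠.lane.carrier.p₀ (S.gk e.1) ≤ 1 / 4 := by
    rw [mul_assoc]; exact hsmall
  -- (68) strict at the constant `C68` (`½C68 < C68`)
  have h68' : pdevOn (loK L e.1 (codeZ e)) (plaqHiK L e.1 (codeZ e) e.2.2.1 e.2.2.2) (liftCfg 𝔊 U₀) <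
      𝔠.C68 * (S.gk e.1 * B10.pFun 𝔠.lane.carrier.b₀ 𝔠.lane.carrier.p₀ (S.gk e.1)) * (((L : ℝ) ^ e.1)⁻¹) ^ 2 := by
    refine lt_of_le_of_lt h68 ?_
    have hpos : 0 < (S.gk e.1 * B10.pFun 𝔠.lane.carrier.b₀ 𝔠.lane.carrier.p₀ (S.gk e.1)) * (((L : ℝ) ^ e.1)⁻¹) ^ 2 := by
      have : (0 : ℝ) < (L : ℝ) ^ e.1 := pow_pos (L_pos S) _
      positivity
    have hC := 𝔠.C68_pos
    nlinarith
  -- the currency-free core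
  have key := smallFactor_of_large69_unitary L hL2 e.1 k hek (liftCfg 𝔊 U₀) (fun x κ => liftCfg_mem_unitaryUnits 𝔊 _ x κ) (codeZ e)
    (ne_of_lt hμν) (gj := S.gk e.1) (gk := S.gk k) (p := B10.pFun 𝔠.lane.carrier.b₀ 𝔠.lane.carrier.p₀ (S.gk e.1)) (C₁ := 𝔠.C68) (C₂ := C₂)
    hgj hgk hpj.le hgp hv h68' h69 hb hbB hsmall'
  -- `(1/g_k²)·(L^k·Σ N(…)) = N·(g_k⁻²·Σ L^k(…))` (pure algebra, summand-wise)
  have hre : ∀ (Δ : Finset (B7Prop1Explicit.Site 3)) (T : B7Prop1Explicit.Site 3 → ℝ),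
      (S.gk k ^ 2)⁻¹ * ((L : ℝ) ^ k * ∑ y ∈ Δ, (𝔊.N : ℝ) * (1 - (𝔊.N : ℝ)⁻¹ * T y))
        = (𝔊.N : ℝ) * ((S.gk k)⁻¹ ^ 2 * ∑ y ∈ Δ, (L : ℝ) ^ k * (1 - (𝔊.N : ℝ)⁻¹ * T y)) := by
    intro Δ T
    rw [Finset.mul_sum, Finset.mul_sum, Finset.mul_sum, Finset.mul_sum]
    refine Finset.sum_congr rfl fun y _ => ?_
    rw [inv_pow]
    ring
  rw [hre] at key
  -- the plaquette bridge: the `regionT` sum on the torus = the `deltaBox` sum of the lift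
  have h2 : 2 * L ^ e.1 ≤ S.P.sitesPerDir 0 := by
    show 2 * L ^ e.1 ≤ 2 * L ^ (S.m + S.K - 0)
    rw [Nat.sub_zero]
    exact Nat.mul_le_mul_left 2 (Nat.pow_le_pow_right (by omega) (by have := heK; omega))
  have hsum : ∑ q ∈ regionT e, (S.eta k)⁻¹ * (1 - reTr (GaugeField.plaqHol U₀ q))
      = ∑ y ∈ deltaBox (L ^ e.1) ((L ^ e.1 : ℕ) • codeZ e) e.2.2.1 e.2.2.2,
          (L : ℝ) ^ k * (1 - (𝔊.N : ℝ)⁻¹ *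
            (((hol (liftCfg 𝔊 U₀) y (plaqWord e.2.2.1 e.2.2.2) : (Matrix (Fin 𝔊.N) (Fin 𝔊.N) ℂ)ˣ) : Matrix (Fin 𝔊.N) (Fin 𝔊.N) ℂ).trace.re)) := by
    unfold Summit.QuantumFields.Balaban3D.Proofs.Run3SmallFactors.regionT
    rw [dif_pos hμν, @Finset.sum_image _ _ _ _ _ (instDecidableEqPlaq (P := S.P) (j := 0)) _ _ ?inj]
    · refine Finset.sum_congr rfl fun y _ => ?_
      exact bridge_liftCfg 𝔊 k U₀ y hμν
    · intro y hy y' hy' hyy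
      exact projSite_injOn_deltaBox h2 _ _ _ hy hy' (congrArg Plaq.src hyy)
  refine key.trans (le_of_eq ?_)
  congr 1
  congr 1
  exact hsum.symm

end Summit.QuantumFields.YangMills.Theorems.SmallFactor71Sym

/-! ## §2 At the T³ objects: the `h71` text for a configuration in `large67RecSet ∩ reg68LocalSet` with (69)_sym -/

namespace Summit.QuantumFields.YangMills.Theorems

open Literature.MathematicalPhysics.QuantumFieldTheory.Balaban1983to89.T3ContinuumYM3Torus
open Literature.MathematicalPhysics.QuantumFieldTheory.Balaban1983to89.T3UnitLawDensityEML (ℰp)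

section T3

variable {F : T3Family} {𝔠 : AlphaConsts F.L (suGroupModel 2).N} {γ : ℝ} {hγ : 0 < γ} {hγ1 : γ ≤ (min 𝔠.gamma0 1) ^ 2} {K : ℕ}

/-- ★★★ **(71) PER RECORDED PLAQUETTE FROM SYMMETRIC LARGENESS, READ-LOCAL (68) AND (69)_sym — the v4 `h71` row text for a configuration `U₀` in the α-currency class rows of B1.**
[cite: Balaban1985UV3, (67)–(71) p.273] -/
theorem AlphaInputsT3AC.h71_of_recLarge_of_eq69sym (hL2 : 2 ≤ F.L) {k : ℕ} (hk : k ≤ K) (h : Hist (F.P K) k)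
    {U₀ : GaugeField (F.P K) 0 (Matrix.specialUnitaryGroup (Fin 2) ℂ)}
    (hLarge : U₀ ∈ AlphaInputsT3AC.large67RecSet F 𝔠 γ hγ hγ1 K k h) (hReg : U₀ ∈ AlphaInputsT3AC.reg68LocalSet F 𝔠 γ hγ hγ1 K k h) {C₂ : ℝ}
    (h69 : ∀ (j : Fin k) (p : Plaq (F.P K) j), p ∈ h j → ∃ b : ℝ, 0 ≤ b ∧
      b ≤ C₂ * (eps1Of (T3Scales F γ hγ (hγ1.trans (sq_min_one_le _ 𝔠.gamma0_pos)) K) 𝔠.lane.carrier j) ^ 2 ∧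
      GaugeGroup.dist1 (GaugeField.plaqHol (Averaging.iter (fun l => BlockAveraging.blockAvg (P := F.P K) (j := l) ℰp) j U₀) p) <
        blockSum (F.L ^ (j : ℕ)) ((F.L ^ (j : ℕ) : ℕ) • zOf p) p.μ p.ν
          (dev (liftCfg (S := T3Scales F γ hγ (hγ1.trans (sq_min_one_le _ 𝔠.gamma0_pos)) K) (suGroupModel 2) U₀) p.μ p.ν) + b)
    (hwin : ∀ j, j < k → eps1Of (T3Scales F γ hγ (hγ1.trans (sq_min_one_le _ 𝔠.gamma0_pos)) K) 𝔠.lane.carrier j ≤ 1 ∧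
      (2 * 𝔠.C68 * C₂ + C₂ ^ 2) / 2 * eps1Of (T3Scales F γ hγ (hγ1.trans (sq_min_one_le _ 𝔠.gamma0_pos)) K) 𝔠.lane.carrier j ≤ 1 / 4)
    (e : ℕ × PlaqCode (F.P K)) (he : e ∈ Hist.disc h) :
    B10.pFun 𝔠.lane.carrier.b₀ 𝔠.lane.carrier.p₀ ((T3Scales F γ hγ (hγ1.trans (sq_min_one_le _ 𝔠.gamma0_pos)) K).gk e.1) ^ 2 / 4 ≤
      ((suGroupModel 2).N : ℝ) * (((T3Scales F γ hγ (hγ1.trans (sq_min_one_le _ 𝔠.gamma0_pos)) K).gk k)⁻¹ ^ 2 *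
        ∑ q ∈ regionT (S := T3Scales F γ hγ (hγ1.trans (sq_min_one_le _ 𝔠.gamma0_pos)) K) e,
          ((T3Scales F γ hγ (hγ1.trans (sq_min_one_le _ 𝔠.gamma0_pos)) K).eta k)⁻¹ * (1 - GaugeGroup.reTr (GaugeField.plaqHol U₀ q))) := by
  obtain ⟨j, hj, p', hp', hej, hz, hμ, hν⟩ := decode_of_mem_disc (S := T3Scales F γ hγ (hγ1.trans (sq_min_one_le _ 𝔠.gamma0_pos)) K) he
  have he1 : e.1 = j := by rw [hej]
  obtain ⟨b, hb, hbB, h69p⟩ := h69 ⟨j, hj⟩ p' hp'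
  refine SmallFactor71Sym.h71_of_large69 (S := T3Scales F γ hγ (hγ1.trans (sq_min_one_le _ 𝔠.gamma0_pos)) K) (𝔊 := suGroupModel 2) (𝔠 := 𝔠)
    hL2 hk U₀ he (v := GaugeGroup.dist1 (GaugeField.plaqHol (Averaging.iter (fun l => BlockAveraging.blockAvg (P := F.P K) (j := l) ℰp) j U₀) p'))
    (b := b) (C₂ := C₂) ?_ (hReg e he) ?_ hb ?_ (hwin e.1 (by omega))
  · rw [he1]; exact hLarge ⟨j, hj⟩ p' hp'
  · rw [he1, hz, hμ, hν]; exact h69p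
  · rw [he1]; exact hbB

end T3

end Summit.QuantumFields.YangMills.Theorems

end
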